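import Literature.Analysis.FluidPDE.TorusWordEnergy
import Literature.Analysis.FluidPDE.TorusWordL2Bounds
import Literature.Analysis.FunctionSpaces.TorusFluidGlueProofs
import HarnessLib

/-!
# Stub `stub_convectWordEstimate` of the line `SketchIdeator2` (card `separatrix-flux-pinning`)
# (crux stmt-AnomalousDissipation-14249, `MarginalStabilityChain.ChainRealisation`)

The **nonlinear word estimate of the `H^m` energy method on `T³`** (sup × `L²` only): for `ν > 0`,
`m ≥ 2` and `A` there is `C = C(ν, m, A)` such that every smooth solenoidal `u : T³ → ℝ³` with
`E_m(u) ≤ A` (`sobolevEnergy m u`, all ordered derivative words of length `≤ m`) satisfies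
`|∑_{|w| ≤ m+1} ∫ ⟪∂^w ((u·∇)u), ∂^w u⟫| ≤ (ν/2) E_{m+2}(u) + C (1 + E_{m+1}(u))` — the estimate of
the convective term closing the word-level energy balances summed over `|w| ≤ m + 1` (Majda 1984,
Ch. 2 §2.1, Prop. 2.1 and proof of Thm. 2.2; Foias–Manley–Rosa–Temam 2001, Ch. II App. A §A.4), in
the tree's word currency (`Torus.wordDeriv`, `Torus.wordEnergy`, `Torus.sobolevEnergy`).

Proof. (1) The word of length `0` gives `∫ ⟪(u·∇)u, u⟫ = 0` (`u` solenoidal,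
`Torus.integral_inner_convect_self_eq_zero`). (2) For `w = i :: w'` of length `n + 1 ≤ m + 1`
integrate `∂ᵢ` by parts (`Torus.integral_inner_partialDeriv_eq_neg`) and use Young:
`|∫ ⟪∂ᵢ ∂^{w'} G, ∂^w u⟫| ≤ (ν/2) ∫ ‖∂ᵢ ∂^w u‖² + (1/2ν) ∫ ‖∂^{w'} G‖²`, `G = (u·∇)u`, where
`∑_{|w| = n+1} ∫ ‖∂_{w₀} ∂^w u‖² ≤ E_{n+2}(u)` (`Torus.wordEnergy_succ'`) sums to `≤ sobolevEnergy (m+2) u`.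
(3) `G = ∑ⱼ uⱼ ∂ⱼu` (`Torus.fderiv_apply_eq_sum_partialDeriv`), so by the Leibniz formula along words
(`Torus.wordDeriv_smul`) `∂^{w'} G` is a sum of `3 · 2^{|w'|}` products `∂^α uⱼ · ∂^β ∂ⱼ u`,
`|α| + |β| = |w'| ≤ m`, and `∫ ‖∂^{w'} G‖² ≤ 9 · 4^m · max ∫ ‖∂^α uⱼ · ∂^β ∂ⱼ u‖²`
(`Torus.integral_norm_sq_list_sum_le`). (4) Each product is `≤ K A E_{m+1}(u)`, `K` the sup constant
of `Torus.exists_norm_sq_wordDeriv_le_sobolevEnergy` (`‖∂^v f‖²_∞ ≤ K E_{|v|+2}(f)` on `T³`): sup on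
`∂^α uⱼ` if `|α| ≤ m − 2` (`≤ K E_m ≤ K A`, the `L²` factor `≤ E_{|β|+1} ≤ E_{m+1}`) or `|α| = m − 1`
(`≤ K E_{m+1}`, the `L²` factor `≤ E_2 ≤ E_m ≤ A`), and sup on `∂ⱼ u` if `|α| = m` (`≤ K E_3 ≤ K E_{m+1}`,
the `L²` factor `≤ E_m ≤ A`). So `C = (∑_{n ≤ m} 3^{n+1}) · 9 · 4^m K A / (2ν)` works.

The statement is the registered stub verbatim, over the skeleton's local notations
`𝕋³ = UnitAddTorus (Fin 3)`, `E³ = EuclideanSpace ℝ (Fin 3)`; `convect`, `partialDeriv`, `IsSmooth`,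
`IsDivFree` are the torus notions of `Literature.Analysis.FunctionSpaces.Torus` and `wordDeriv`,
`wordEnergy`, `sobolevEnergy` those of `Literature.Analysis.FluidPDE.Torus` (see the `example`s).

References: A. Majda, *Compressible Fluid Flow and Systems of Conservation Laws in Several Space
Variables*, Springer 1984, Ch. 2 §2.1; C. Foias, O. Manley, R. Rosa, R. Temam, *Navier–Stokes
Equations and Turbulence*, CUP 2001, Ch. II App. A §A.4.
-/

-- `Summit.<Summit>.<Problem>` is the tree's mandated summit-side namespace (CONVENTIONS §2); for this
-- single-conjunct summit the two coincide, so the duplicate is deliberate.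
set_option linter.dupNamespace false

noncomputable section

open MeasureTheory Set Filter Topology
open scoped InnerProductSpace
open Literature.Analysis.FunctionSpaces Literature.Analysis.FunctionSpaces.Torus
open Literature.Analysis.FluidPDE Literature.Analysis.FluidPDE.Torus

namespace Summit.AnomalousDissipation.AnomalousDissipation.Theorems.ChainRealisation.SeparatrixFluxPinning

/-- Local notation (as in the skeleton): the torus `T³`. -/
local notation "𝕋³" => UnitAddTorus (Fin 3)
/-- Local notation (as in the skeleton): velocity values. -/
local notation "E³" => EuclideanSpace ℝ (Fin 3)

/-- Sanity check: with the opens above, `convect` on torus fields is `Torus.convect`. -/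
example : (convect : (𝕋³ → E³) → (𝕋³ → E³) → 𝕋³ → E³) = Torus.convect := rfl

/-- Sanity check: with the opens above, `sobolevEnergy` is the torus Sobolev energy of `TorusWordEnergy`. -/
example : (sobolevEnergy : ℕ → (𝕋³ → E³) → ℝ) = Literature.Analysis.FluidPDE.Torus.sobolevEnergy := rfl

/-! ## Tools: integration by parts and Young, sup × `L²`, words as lists -/

/-- **Integration by parts and Young**: `|∫ ⟪∂ᵢ a, b⟫| ≤ (ν/2) ∫ ‖∂ᵢ b‖² + (1/2ν) ∫ ‖a‖²` for smooth
fields `a, b` on `T³` (`∫ ⟪∂ᵢ a, b⟫ = −∫ ⟪a, ∂ᵢ b⟫`, `Torus.integral_inner_partialDeriv_eq_neg`). -/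
theorem cwe_abs_integral_inner_partialDeriv_le {ν : ℝ} (hν : 0 < ν) {a b : 𝕋³ → E³}
    (ha : IsSmooth a) (hb : IsSmooth b) (i : Fin 3) :
    |∫ x, ⟪partialDeriv i a x, b x⟫_ℝ| ≤
      ν / 2 * (∫ x, ‖partialDeriv i b x‖ ^ 2) + 1 / (2 * ν) * ∫ x, ‖a x‖ ^ 2 := by
  rw [integral_inner_partialDeriv_eq_neg ha hb i, abs_neg]
  -- Young: `p q ≤ (ν/2) q² + p²/(2ν)`
  have young : ∀ p q : ℝ, p * q ≤ ν / 2 * q ^ 2 + 1 / (2 * ν) * p ^ 2 := fun p q => by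
    have key : ν / 2 * q ^ 2 + 1 / (2 * ν) * p ^ 2 - p * q = (ν * q - p) ^ 2 / (2 * ν) := by
      field_simp
      ring
    have h0 : 0 ≤ (ν * q - p) ^ 2 / (2 * ν) := by positivity
    linarith
  have hint : Integrable (fun x => ⟪a x, partialDeriv i b x⟫_ℝ) volume :=
    (ha.inner (hb.partialDeriv i)).integrable
  have hcb : Continuous fun x => ‖partialDeriv i b x‖ ^ 2 := (hb.partialDeriv i).continuous.norm.pow 2
  have hca : Continuous fun x => ‖a x‖ ^ 2 := ha.continuous.norm.pow 2
  calc |∫ x, ⟪a x, partialDeriv i b x⟫_ℝ| ≤ ∫ x, |⟪a x, partialDeriv i b x⟫_ℝ| :=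
        abs_integral_le_integral_abs
    _ ≤ ∫ x, (ν / 2 * ‖partialDeriv i b x‖ ^ 2 + 1 / (2 * ν) * ‖a x‖ ^ 2) :=
        integral_mono hint.abs
          ((hcb.integrable_unitAddTorus.const_mul _).add (hca.integrable_unitAddTorus.const_mul _))
          fun x => (abs_real_inner_le_norm _ _).trans (young _ _)
    _ = ν / 2 * (∫ x, ‖partialDeriv i b x‖ ^ 2) + 1 / (2 * ν) * ∫ x, ‖a x‖ ^ 2 := by
        rw [integral_add (hcb.integrable_unitAddTorus.const_mul _) (hca.integrable_unitAddTorus.const_mul _),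
          integral_const_mul, integral_const_mul]

/-- `∫ ‖φ • ψ‖² ≤ S ∫ ‖ψ‖²` when `φ² ≤ S` pointwise (continuous `φ, ψ`). -/
theorem cwe_integral_norm_sq_smul_le_left {φ : 𝕋³ → ℝ} {ψ : 𝕋³ → E³} (hφ : Continuous φ)
    (hψ : Continuous ψ) {S : ℝ} (hS : ∀ x, φ x ^ 2 ≤ S) :
    ∫ x, ‖φ x • ψ x‖ ^ 2 ≤ S * ∫ x, ‖ψ x‖ ^ 2 := by
  rw [← integral_const_mul]
  refine integral_mono ((hφ.smul hψ).norm.pow 2).integrable_unitAddTorus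
    ((hψ.norm.pow 2).integrable_unitAddTorus.const_mul S) fun x => ?_
  dsimp only
  rw [norm_smul, mul_pow, Real.norm_eq_abs, sq_abs]
  exact mul_le_mul_of_nonneg_right (hS x) (sq_nonneg _)

/-- `∫ ‖φ • ψ‖² ≤ S ∫ φ²` when `‖ψ‖² ≤ S` pointwise (continuous `φ, ψ`). -/
theorem cwe_integral_norm_sq_smul_le_right {φ : 𝕋³ → ℝ} {ψ : 𝕋³ → E³} (hφ : Continuous φ)
    (hψ : Continuous ψ) {S : ℝ} (hS : ∀ x, ‖ψ x‖ ^ 2 ≤ S) :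
    ∫ x, ‖φ x • ψ x‖ ^ 2 ≤ S * ∫ x, φ x ^ 2 := by
  rw [← integral_const_mul]
  refine integral_mono ((hφ.smul hψ).norm.pow 2).integrable_unitAddTorus
    ((hφ.pow 2).integrable_unitAddTorus.const_mul S) fun x => ?_
  dsimp only
  rw [norm_smul, mul_pow, Real.norm_eq_abs, sq_abs, mul_comm]
  exact mul_le_mul_of_nonneg_right (hS x) (sq_nonneg _)

/-- A single word (given as a list) is dominated by the word energy of its length. -/
theorem cwe_integral_norm_sq_wordDeriv_le (w : List (Fin 3)) (f : 𝕋³ → E³) :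
    ∫ x, ‖wordDeriv w f x‖ ^ 2 ≤ wordEnergy w.length f := by
  have h := integral_norm_sq_wordDeriv_le_wordEnergy (List.get w) f
  rwa [List.ofFn_get] at h

/-- The word-level sup bound `‖∂^w f‖²_∞ ≤ K E_{m'}(f)`, `|w| + 2 ≤ m'`, for words given as lists
(from the `List.ofFn` form of `Torus.exists_norm_sq_wordDeriv_le_sobolevEnergy`). -/
theorem cwe_norm_sq_wordDeriv_le {K : ℝ}
    (hK : ∀ f : 𝕋³ → E³, IsSmooth f → ∀ {n m : ℕ}, n + 2 ≤ m →
      ∀ (v : Fin n → Fin 3) (x : 𝕋³), ‖wordDeriv (List.ofFn v) f x‖ ^ 2 ≤ K * sobolevEnergy m f)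
    {f : 𝕋³ → E³} (hf : IsSmooth f) (w : List (Fin 3)) {m : ℕ} (hm : w.length + 2 ≤ m) (x : 𝕋³) :
    ‖wordDeriv w f x‖ ^ 2 ≤ K * sobolevEnergy m f := by
  have h := hK f hf hm (List.get w) x
  rwa [List.ofFn_get] at h

/-- Components commute with word derivatives: `∂^w (uⱼ) = (∂^w u)ⱼ` (the coordinate projection is
a continuous linear map, `Torus.wordDeriv_clm_comp`). -/
theorem cwe_wordDeriv_apply_coord {u : 𝕋³ → E³} (hu : IsSmooth u) (j : Fin 3) (w : List (Fin 3))
    (x : 𝕋³) : wordDeriv w (fun y => u y j) x = wordDeriv w u x j :=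
  congrFun (wordDeriv_clm_comp hu (EuclideanSpace.proj j : E³ →L[ℝ] ℝ) w) x

/-! ## The convective term along words -/

/-- `(u·∇)u = ∑ⱼ uⱼ ∂ⱼu` as a `List` sum of functions over `j ∈ Fin 3`. -/
theorem cwe_convect_eq_list_sum {u : 𝕋³ → E³} (hu : IsSmooth u) :
    convect u u =
      ((List.finRange 3).map fun (j : Fin 3) (y : 𝕋³) => u y j • partialDeriv j u y).sum := by
  funext x
  rw [list_sum_apply, ← Fin.sum_univ_def]
  exact fderiv_apply_eq_sum_partialDeriv (hu.isContDiff (by simp)) x (u x)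

/-- `∂^w ((u·∇)u) = ∑ⱼ ∂^w (uⱼ ∂ⱼu)` (linearity of `∂^w`, `Torus.wordDeriv_list_sum`). -/
theorem cwe_wordDeriv_convect {u : 𝕋³ → E³} (hu : IsSmooth u) (w : List (Fin 3)) :
    wordDeriv w (convect u u) =
      ((List.finRange 3).map fun j : Fin 3 => wordDeriv w (fun y => u y j • partialDeriv j u y)).sum := by
  rw [cwe_convect_eq_list_sum hu]
  exact wordDeriv_list_sum (List.finRange 3) (fun j _ => (hu.apply j).smul' (hu.partialDeriv j)) w

/-- `∫ ‖∂^w ((u·∇)u)‖² ≤ 9 B` if `∫ ‖∂^w (uⱼ ∂ⱼu)‖² ≤ B` for each `j`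
(`Torus.integral_norm_sq_list_sum_le` over the three components). -/
theorem cwe_integral_norm_sq_wordDeriv_convect_le {u : 𝕋³ → E³} (hu : IsSmooth u) (w : List (Fin 3))
    {B : ℝ} (hB : ∀ j : Fin 3, ∫ x, ‖wordDeriv w (fun y => u y j • partialDeriv j u y) x‖ ^ 2 ≤ B) :
    ∫ x, ‖wordDeriv w (convect u u) x‖ ^ 2 ≤ 9 * B := by
  rw [cwe_wordDeriv_convect hu w]
  have h := integral_norm_sq_list_sum_le (List.finRange 3)
    (g := fun j : Fin 3 => wordDeriv w (fun y => u y j • partialDeriv j u y))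
    (fun j _ => (isSmooth_wordDeriv ((hu.apply j).smul' (hu.partialDeriv j)) w).continuous)
  refine h.trans ?_
  calc _ ≤ ((List.finRange 3).length : ℝ) * ∑ _k : Fin (List.finRange 3).length, B :=
        mul_le_mul_of_nonneg_left (Finset.sum_le_sum fun k _ => hB _) (Nat.cast_nonneg _)
    _ = 9 * B := by
        simp only [Finset.sum_const, Finset.card_univ, Fintype.card_fin, List.length_finRange, nsmul_eq_mul,
          Nat.cast_ofNat]
        ring

/-- `∫ ‖∂^w (uⱼ ∂ⱼu)‖² ≤ 4^{|w|} P` if every Leibniz product `∫ ‖∂^α uⱼ • ∂^β ∂ⱼu‖²`, `(α, β) ∈ splits w`,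
is `≤ P` (`Torus.wordDeriv_smul`, `Torus.integral_norm_sq_list_sum_le`, `|splits w| = 2^{|w|}`). -/
theorem cwe_integral_norm_sq_wordDeriv_smul_le {u : 𝕋³ → E³} (hu : IsSmooth u) (w : List (Fin 3))
    (j : Fin 3) {P : ℝ}
    (hP : ∀ p ∈ splits w,
      ∫ x, ‖wordDeriv p.1 (fun y => u y j) x • wordDeriv p.2 (partialDeriv j u) x‖ ^ 2 ≤ P) :
    ∫ x, ‖wordDeriv w (fun y => u y j • partialDeriv j u y) x‖ ^ 2 ≤ (4 : ℝ) ^ w.length * P := by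
  rw [wordDeriv_smul (hu.apply j) (hu.partialDeriv j) w]
  have h := integral_norm_sq_list_sum_le (splits w)
    (g := fun p : List (Fin 3) × List (Fin 3) => fun x =>
      wordDeriv p.1 (fun y => u y j) x • wordDeriv p.2 (partialDeriv j u) x)
    (fun p _ => ((isSmooth_wordDeriv (hu.apply j) p.1).smul'
      (isSmooth_wordDeriv (hu.partialDeriv j) p.2)).continuous)
  refine h.trans ?_
  have h4 : (4 : ℝ) ^ w.length = 2 ^ w.length * 2 ^ w.length := by
    rw [← mul_pow]; norm_num
  calc _ ≤ ((splits w).length : ℝ) * ∑ _k : Fin (splits w).length, P :=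
        mul_le_mul_of_nonneg_left (Finset.sum_le_sum fun k _ => hP _ (List.get_mem _ _)) (Nat.cast_nonneg _)
    _ = (4 : ℝ) ^ w.length * P := by
        rw [Finset.sum_const, Finset.card_univ, Fintype.card_fin, nsmul_eq_mul, length_splits, h4]
        push_cast
        ring

/-- **One Leibniz product**: for smooth `u` with `E_m(u) ≤ A`, `m ≥ 2`, and `|α| + |β| ≤ m`,
`∫ ‖∂^α uⱼ • ∂^β ∂ⱼ u‖² ≤ K A E_{m+1}(u)`, `K` the word-level sup constant on `T³`: sup × `L²` with the
sup norm on `∂^α uⱼ` when `|α| ≤ m − 1` and on `∂ⱼ u` when `|α| = m`. -/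
theorem cwe_product_le {K : ℝ} (hK0 : 0 ≤ K)
    (hK : ∀ f : 𝕋³ → E³, IsSmooth f → ∀ {n m : ℕ}, n + 2 ≤ m →
      ∀ (v : Fin n → Fin 3) (x : 𝕋³), ‖wordDeriv (List.ofFn v) f x‖ ^ 2 ≤ K * sobolevEnergy m f)
    {u : 𝕋³ → E³} (hu : IsSmooth u) {m : ℕ} (hm : 2 ≤ m) {A : ℝ} (hA : sobolevEnergy m u ≤ A)
    (α β : List (Fin 3)) (hαβ : α.length + β.length ≤ m) (j : Fin 3) :
    ∫ x, ‖wordDeriv α (fun y => u y j) x • wordDeriv β (partialDeriv j u) x‖ ^ 2 ≤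
      K * A * sobolevEnergy (m + 1) u := by
  have hφc : Continuous (wordDeriv α (fun y => u y j)) := (isSmooth_wordDeriv (hu.apply j) α).continuous
  have hψc : Continuous (wordDeriv β (partialDeriv j u)) :=
    (isSmooth_wordDeriv (hu.partialDeriv j) β).continuous
  have hψ : wordDeriv β (partialDeriv j u) = wordDeriv (β ++ [j]) u := (wordDeriv_concat β j u).symm
  have hlen : (β ++ [j]).length = β.length + 1 := by simp
  have hE0 : ∀ k, 0 ≤ sobolevEnergy k u := fun k => sobolevEnergy_nonneg k u
  have hA0 : 0 ≤ A := (hE0 m).trans hA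
  -- pointwise `|∂^α uⱼ|² ≤ ‖∂^α u‖²`
  have hφpt : ∀ x, wordDeriv α (fun y => u y j) x ^ 2 ≤ ‖wordDeriv α u x‖ ^ 2 := fun x => by
    rw [cwe_wordDeriv_apply_coord hu j α x, ← sq_abs, ← Real.norm_eq_abs]
    exact pow_le_pow_left₀ (norm_nonneg _) (PiLp.norm_apply_le (wordDeriv α u x) j) 2
  -- the `L²` bounds of the two factors
  have hφL2 : ∫ x, wordDeriv α (fun y => u y j) x ^ 2 ≤ wordEnergy α.length u :=
    (integral_mono ((hφc.pow 2).integrable_unitAddTorus)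
      (((isSmooth_wordDeriv hu α).continuous.norm.pow 2).integrable_unitAddTorus) hφpt).trans
      (cwe_integral_norm_sq_wordDeriv_le α u)
  have hψL2 : ∫ x, ‖wordDeriv β (partialDeriv j u) x‖ ^ 2 ≤ wordEnergy (β.length + 1) u := by
    rw [hψ, ← hlen]
    exact cwe_integral_norm_sq_wordDeriv_le (β ++ [j]) u
  rcases Nat.lt_or_ge (α.length + 1) m with h1 | h1
  · -- `|α| ≤ m - 2`: sup on `∂^α uⱼ` by `K E_m ≤ K A`, `L²` factor by `E_{m+1}`
    have hsup : ∀ x, wordDeriv α (fun y => u y j) x ^ 2 ≤ K * A := fun x =>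
      (hφpt x).trans ((cwe_norm_sq_wordDeriv_le hK hu α (show α.length + 2 ≤ m by omega) x).trans
        (mul_le_mul_of_nonneg_left hA hK0))
    calc ∫ x, ‖wordDeriv α (fun y => u y j) x • wordDeriv β (partialDeriv j u) x‖ ^ 2
        ≤ K * A * ∫ x, ‖wordDeriv β (partialDeriv j u) x‖ ^ 2 :=
          cwe_integral_norm_sq_smul_le_left hφc hψc hsup
      _ ≤ K * A * sobolevEnergy (m + 1) u :=
          mul_le_mul_of_nonneg_left (hψL2.trans (wordEnergy_le_sobolevEnergy (by omega) u))
            (mul_nonneg hK0 hA0)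
  · rcases Nat.lt_or_ge α.length m with h2 | h2
    · -- `|α| = m - 1`, `|β| ≤ 1`: sup on `∂^α uⱼ` by `K E_{m+1}`, `L²` factor by `E_2 ≤ E_m ≤ A`
      have hsup : ∀ x, wordDeriv α (fun y => u y j) x ^ 2 ≤ K * sobolevEnergy (m + 1) u := fun x =>
        (hφpt x).trans (cwe_norm_sq_wordDeriv_le hK hu α (show α.length + 2 ≤ m + 1 by omega) x)
      calc ∫ x, ‖wordDeriv α (fun y => u y j) x • wordDeriv β (partialDeriv j u) x‖ ^ 2
          ≤ K * sobolevEnergy (m + 1) u * ∫ x, ‖wordDeriv β (partialDeriv j u) x‖ ^ 2 :=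
            cwe_integral_norm_sq_smul_le_left hφc hψc hsup
        _ ≤ K * sobolevEnergy (m + 1) u * A :=
            mul_le_mul_of_nonneg_left
              (hψL2.trans ((wordEnergy_le_sobolevEnergy (by omega) u).trans hA))
              (mul_nonneg hK0 (hE0 _))
        _ = K * A * sobolevEnergy (m + 1) u := by ring
    · -- `|α| = m`, `β = []`: sup on `∂ⱼ u` by `K E_3 ≤ K E_{m+1}`, `L²` factor by `E_m ≤ A`
      have hsup : ∀ x, ‖wordDeriv β (partialDeriv j u) x‖ ^ 2 ≤ K * sobolevEnergy (m + 1) u := fun x => by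
        rw [hψ]
        exact cwe_norm_sq_wordDeriv_le hK hu (β ++ [j]) (by rw [hlen]; omega) x
      calc ∫ x, ‖wordDeriv α (fun y => u y j) x • wordDeriv β (partialDeriv j u) x‖ ^ 2
          ≤ K * sobolevEnergy (m + 1) u * ∫ x, wordDeriv α (fun y => u y j) x ^ 2 :=
            cwe_integral_norm_sq_smul_le_right hφc hψc hsup
        _ ≤ K * sobolevEnergy (m + 1) u * A :=
            mul_le_mul_of_nonneg_left
              (hφL2.trans ((wordEnergy_le_sobolevEnergy (by omega) u).trans hA))
              (mul_nonneg hK0 (hE0 _))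
        _ = K * A * sobolevEnergy (m + 1) u := by ring

/-- **`L²` bound of `∂^w ((u·∇)u)`**: for smooth `u` with `E_m(u) ≤ A`, `m ≥ 2`, and `|w| ≤ m`,
`∫ ‖∂^w ((u·∇)u)‖² ≤ 9 · 4^m · K A · E_{m+1}(u)` — LINEAR in `E_{m+1}(u)`. -/
theorem cwe_wordDeriv_convect_l2_le {K : ℝ} (hK0 : 0 ≤ K)
    (hK : ∀ f : 𝕋³ → E³, IsSmooth f → ∀ {n m : ℕ}, n + 2 ≤ m →
      ∀ (v : Fin n → Fin 3) (x : 𝕋³), ‖wordDeriv (List.ofFn v) f x‖ ^ 2 ≤ K * sobolevEnergy m f)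
    {u : 𝕋³ → E³} (hu : IsSmooth u) {m : ℕ} (hm : 2 ≤ m) {A : ℝ} (hA : sobolevEnergy m u ≤ A)
    (w : List (Fin 3)) (hw : w.length ≤ m) :
    ∫ x, ‖wordDeriv w (convect u u) x‖ ^ 2 ≤ 9 * 4 ^ m * K * A * sobolevEnergy (m + 1) u := by
  have hA0 : 0 ≤ A := (sobolevEnergy_nonneg m u).trans hA
  have hP0 : 0 ≤ K * A * sobolevEnergy (m + 1) u := mul_nonneg (mul_nonneg hK0 hA0) (sobolevEnergy_nonneg _ _)
  have hB : ∀ j : Fin 3, ∫ x, ‖wordDeriv w (fun y => u y j • partialDeriv j u y) x‖ ^ 2 ≤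
      (4 : ℝ) ^ m * (K * A * sobolevEnergy (m + 1) u) := fun j =>
    (cwe_integral_norm_sq_wordDeriv_smul_le hu w j fun p hp =>
      cwe_product_le hK0 hK hu hm hA p.1 p.2 ((mem_splits_length hp).le.trans hw) j).trans
      (mul_le_mul_of_nonneg_right (pow_le_pow_right₀ (by norm_num) hw) hP0)
  have h := cwe_integral_norm_sq_wordDeriv_convect_le hu w hB
  calc ∫ x, ‖wordDeriv w (convect u u) x‖ ^ 2 ≤ 9 * ((4 : ℝ) ^ m * (K * A * sobolevEnergy (m + 1) u)) := h
    _ = 9 * 4 ^ m * K * A * sobolevEnergy (m + 1) u := by ring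

/-! ## One word of the pairing, and the bookkeeping of the sums -/

/-- **One word of length `n + 1`**: `|∫ ⟪∂^v ((u·∇)u), ∂^v u⟫| ≤ (ν/2) ∫ ‖∂_{v₀} ∂^v u‖² + D/(2ν)`
whenever `∫ ‖∂^{v'} ((u·∇)u)‖² ≤ D`, `v'` the tail of `v` (integration of `∂_{v₀}` by parts and Young). -/
theorem cwe_word_pairing_le {ν : ℝ} (hν : 0 < ν) {u : 𝕋³ → E³} (hu : IsSmooth u) {n : ℕ}
    (v : Fin (n + 1) → Fin 3) {D : ℝ}
    (hD : ∫ x, ‖wordDeriv (List.ofFn fun i : Fin n => v i.succ) (convect u u) x‖ ^ 2 ≤ D) :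
    |∫ x, ⟪wordDeriv (List.ofFn v) (convect u u) x, wordDeriv (List.ofFn v) u x⟫_ℝ| ≤
      ν / 2 * (∫ x, ‖partialDeriv (v 0) (wordDeriv (List.ofFn v) u) x‖ ^ 2) + 1 / (2 * ν) * D := by
  have hG : IsSmooth (convect u u) := hu.convect hu
  have e : wordDeriv (List.ofFn v) (convect u u) =
      partialDeriv (v 0) (wordDeriv (List.ofFn fun i : Fin n => v i.succ) (convect u u)) := by
    rw [List.ofFn_succ, wordDeriv_cons]
  rw [e]
  refine (cwe_abs_integral_inner_partialDeriv_le hν (isSmooth_wordDeriv hG _)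
    (isSmooth_wordDeriv hu (List.ofFn v)) (v 0)).trans ?_
  exact add_le_add le_rfl (mul_le_mul_of_nonneg_left hD (by positivity : (0 : ℝ) ≤ 1 / (2 * ν)))

/-- Heads of words: `∑_{|v| = n+1} ∫ ‖∂_{v₀} ∂^v u‖² ≤ E_{n+2}(u)` (`Torus.wordEnergy_succ'`). -/
theorem cwe_sum_head_le (u : 𝕋³ → E³) (n : ℕ) :
    ∑ v : Fin (n + 1) → Fin 3, ∫ x, ‖partialDeriv (v 0) (wordDeriv (List.ofFn v) u) x‖ ^ 2 ≤
      wordEnergy (n + 1 + 1) u := by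
  rw [wordEnergy_succ' (n + 1) u]
  exact Finset.sum_le_sum fun v _ =>
    Finset.single_le_sum (f := fun i => ∫ x, ‖partialDeriv i (wordDeriv (List.ofFn v) u) x‖ ^ 2)
      (fun i _ => integral_nonneg fun x => sq_nonneg _) (Finset.mem_univ (v 0))

/-- Summed over the lengths: `∑_{n ≤ m} ∑_{|v| = n+1} ∫ ‖∂_{v₀} ∂^v u‖² ≤ sobolevEnergy (m+2) u`. -/
theorem cwe_sum_sum_head_le (u : 𝕋³ → E³) (m : ℕ) :
    ∑ n ∈ Finset.range (m + 1), ∑ v : Fin (n + 1) → Fin 3,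
        ∫ x, ‖partialDeriv (v 0) (wordDeriv (List.ofFn v) u) x‖ ^ 2 ≤ sobolevEnergy (m + 2) u := by
  have h3 : sobolevEnergy (m + 2) u =
      ∑ n ∈ Finset.range (m + 1), wordEnergy (n + 1 + 1) u + wordEnergy (0 + 1) u + wordEnergy 0 u := by
    unfold sobolevEnergy
    rw [Finset.sum_range_succ', Finset.sum_range_succ']
  rw [h3]
  have h0 := wordEnergy_nonneg 0 u
  have h1 := wordEnergy_nonneg (0 + 1) u
  have h2 : ∑ n ∈ Finset.range (m + 1), ∑ v : Fin (n + 1) → Fin 3,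
      ∫ x, ‖partialDeriv (v 0) (wordDeriv (List.ofFn v) u) x‖ ^ 2 ≤
      ∑ n ∈ Finset.range (m + 1), wordEnergy (n + 1 + 1) u :=
    Finset.sum_le_sum fun n _ => cwe_sum_head_le u n
  linarith

/-- Bookkeeping: `∑ₙ ∑ᵥ (a bₙᵥ + c) = a ∑ₙ ∑ᵥ bₙᵥ + (∑ₙ #{v}) c`. -/
theorem cwe_sum_sum_add_const (m : ℕ) (b : (n : ℕ) → (Fin (n + 1) → Fin 3) → ℝ) (a c : ℝ) :
    ∑ n ∈ Finset.range (m + 1), ∑ v : Fin (n + 1) → Fin 3, (a * b n v + c) =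
      a * ∑ n ∈ Finset.range (m + 1), ∑ v : Fin (n + 1) → Fin 3, b n v +
        (∑ n ∈ Finset.range (m + 1), (Fintype.card (Fin (n + 1) → Fin 3) : ℝ)) * c := by
  simp only [Finset.sum_add_distrib, Finset.mul_sum, Finset.sum_mul, Finset.sum_const, Finset.card_univ,
    nsmul_eq_mul]

/-! ## The estimate -/

/-- Stub B1 (L) **the nonlinear word estimate of the `H^m` energy method on `T³`** (sup × `L²` only).  For `m ≥ 2`, `A`
there is `C = C(ν, m, A)` such that every smooth solenoidal `u` with `E_m(u) ≤ A` (`sobolevEnergy m u`, all ordered words of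
length `≤ m`) satisfies `|∑_{|w| ≤ m+1} ∫⟪∂^w((u·∇)u), ∂^w u⟫| ≤ (ν/2) E_{m+2}(u) + C (1 + E_{m+1}(u))`: integrate the head
letter by parts and use Young (`cwe_word_pairing_le`), bound `∫ ‖∂^{w'}((u·∇)u)‖²` linearly in `E_{m+1}(u)` by Leibniz along
words and sup × `L²` (`cwe_wordDeriv_convect_l2_le`); the word of length `0` contributes `∫⟪(u·∇)u, u⟫ = 0`.
(Majda 1984 Ch. 2 Prop. 2.1; FMRT 2001 Ch. II §A.4.) -/
theorem stub_convectWordEstimate :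
    ∀ (ν : ℝ) (m : ℕ) (A : ℝ), 0 < ν → 2 ≤ m → ∃ C : ℝ, ∀ u : 𝕋³ → E³, IsSmooth u → IsDivFree u →
      sobolevEnergy m u ≤ A →
      |∑ n ∈ Finset.range (m + 2), ∑ v : Fin n → Fin 3,
          ∫ x, ⟪wordDeriv (List.ofFn v) (convect u u) x, wordDeriv (List.ofFn v) u x⟫_ℝ| ≤
        ν / 2 * sobolevEnergy (m + 2) u + C * (1 + sobolevEnergy (m + 1) u) := by
  intro ν m A hν hm
  obtain ⟨K, hK0, hK⟩ := exists_norm_sq_wordDeriv_le_sobolevEnergy (EuclideanSpace ℝ (Fin 3))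
  refine ⟨(∑ n ∈ Finset.range (m + 1), (Fintype.card (Fin (n + 1) → Fin 3) : ℝ)) *
    (1 / (2 * ν) * (9 * 4 ^ m * K * A)), fun u hu hdiv hA => ?_⟩
  have hA0 : 0 ≤ A := (sobolevEnergy_nonneg m u).trans hA
  -- every word of length `n + 1 ≤ m + 1`
  have hword : ∀ n ∈ Finset.range (m + 1), ∀ v : Fin (n + 1) → Fin 3,
      |∫ x, ⟪wordDeriv (List.ofFn v) (convect u u) x, wordDeriv (List.ofFn v) u x⟫_ℝ| ≤
        ν / 2 * (∫ x, ‖partialDeriv (v 0) (wordDeriv (List.ofFn v) u) x‖ ^ 2) +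
          1 / (2 * ν) * (9 * 4 ^ m * K * A * sobolevEnergy (m + 1) u) := by
    intro n hn v
    have hn' : n ≤ m := Nat.lt_succ_iff.mp (Finset.mem_range.mp hn)
    refine cwe_word_pairing_le hν hu v ?_
    have hl : (List.ofFn fun i : Fin n => v i.succ).length ≤ m := by
      rw [List.length_ofFn]; exact hn'
    exact cwe_wordDeriv_convect_l2_le hK0.le hK hu hm hA _ hl
  -- the word of length `0` does not contribute (`u` is solenoidal)
  have hzero : ∑ v : Fin 0 → Fin 3,
      ∫ x, ⟪wordDeriv (List.ofFn v) (convect u u) x, wordDeriv (List.ofFn v) u x⟫_ℝ = 0 := by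
    refine Finset.sum_eq_zero fun v _ => ?_
    simp only [List.ofFn_zero, wordDeriv_nil]
    exact integral_inner_convect_self_eq_zero hu hdiv
  rw [Finset.sum_range_succ', hzero, add_zero]
  have hfin : (∑ n ∈ Finset.range (m + 1), (Fintype.card (Fin (n + 1) → Fin 3) : ℝ)) *
      (1 / (2 * ν) * (9 * 4 ^ m * K * A * sobolevEnergy (m + 1) u)) ≤
      (∑ n ∈ Finset.range (m + 1), (Fintype.card (Fin (n + 1) → Fin 3) : ℝ)) *
        (1 / (2 * ν) * (9 * 4 ^ m * K * A)) * (1 + sobolevEnergy (m + 1) u) := by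
    have hP : 0 ≤ (∑ n ∈ Finset.range (m + 1), (Fintype.card (Fin (n + 1) → Fin 3) : ℝ)) *
        (1 / (2 * ν) * (9 * 4 ^ m * K * A)) := by positivity
    linarith
  calc |∑ n ∈ Finset.range (m + 1), ∑ v : Fin (n + 1) → Fin 3,
          ∫ x, ⟪wordDeriv (List.ofFn v) (convect u u) x, wordDeriv (List.ofFn v) u x⟫_ℝ|
      ≤ ∑ n ∈ Finset.range (m + 1), ∑ v : Fin (n + 1) → Fin 3,
          (ν / 2 * (∫ x, ‖partialDeriv (v 0) (wordDeriv (List.ofFn v) u) x‖ ^ 2) +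
            1 / (2 * ν) * (9 * 4 ^ m * K * A * sobolevEnergy (m + 1) u)) :=
        (Finset.abs_sum_le_sum_abs _ _).trans (Finset.sum_le_sum fun n hn =>
          (Finset.abs_sum_le_sum_abs _ _).trans (Finset.sum_le_sum fun v _ => hword n hn v))
    _ = ν / 2 * (∑ n ∈ Finset.range (m + 1), ∑ v : Fin (n + 1) → Fin 3,
          ∫ x, ‖partialDeriv (v 0) (wordDeriv (List.ofFn v) u) x‖ ^ 2) +
          (∑ n ∈ Finset.range (m + 1), (Fintype.card (Fin (n + 1) → Fin 3) : ℝ)) *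
            (1 / (2 * ν) * (9 * 4 ^ m * K * A * sobolevEnergy (m + 1) u)) :=
        cwe_sum_sum_add_const m (fun n v => ∫ x, ‖partialDeriv (v 0) (wordDeriv (List.ofFn v) u) x‖ ^ 2) _ _
    _ ≤ ν / 2 * sobolevEnergy (m + 2) u +
          (∑ n ∈ Finset.range (m + 1), (Fintype.card (Fin (n + 1) → Fin 3) : ℝ)) *
            (1 / (2 * ν) * (9 * 4 ^ m * K * A)) * (1 + sobolevEnergy (m + 1) u) :=
        add_le_add (mul_le_mul_of_nonneg_left (cwe_sum_sum_head_le u m) (by positivity)) hfin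

end Summit.AnomalousDissipation.AnomalousDissipation.Theorems.ChainRealisation.SeparatrixFluxPinning

end
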